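import Literature.NumberTheory.BeurlingPrimes.PrescribedZerosMultiset
import Literature.NumberTheory.BeurlingPrimes.BDRMultisetZetaBound
import Literature.NumberTheory.BeurlingPrimes.BDRMultisetIntegers
import Literature.NumberTheory.BeurlingPrimes.WellBehavedSystemsProofs
import Mathlib.MeasureTheory.Integral.Bochner.ContinuousLinearMap
import HarnessLib

/-!
# Broucke–Debruyne–Révész 2023, Theorem 3.2 (complex multisets): proof of `BrouckeDebruyneRevesz2023_thm32_multiset`

Topic `Literature/NumberTheory/BeurlingPrimes`. Everything in this file is PROVED.

The printed proof (arXiv:2309.01567, §3, pp. 7–10), formalised along its own architecture: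
1. the template `F = li + Σ li(x^ω) − Σ li(x^ρ) + M li(x^δ)` in real-part form and Lemma 3.1 (`F′ > 0` for
   `M ≥ M₀`) — `BDRMultisetTemplate.lean`, `BDRMultisetFubini.lean`, `BDRMultisetStieltjes.lean`;
2. Broucke–Vindas' Theorem 1.2 (tree `BrouckeVindas2024_thm12_holds`) applied to `F`: a system `𝒫` with
   `|π_𝒫 − F| ≤ 2` and (1.3);
3. `Π_𝒫 = G + O(log x)` and the `ψ`-clause — `BDRMultisetPrimes.lean`;
4. `Z(s) = ℳ{dΠ_𝒫 − dG; s}` holomorphic on `Re s > 0`, `ζ_𝒫 = E_M e^Z`, and the bound (3.4) on `Re s > 1/2` —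
   `BDRMultisetZeta.lean`, `BDRMultisetZetaBound.lean` (via the tree's `BVContinuation.lean`);
5. Perron inversion with the residues at `s = 1` and at the `ω ∈ 𝒮` with `Re ω > 1/2` (order `m_ω`) —
   `BDRMultisetContZeta.lean`, `BDRMultisetResidues.lean`, `BDRMultisetPerron.lean`, `BDRMultisetIntegers.lean`.

## References
* [BrouckeDebruyneRevesz2023] F. Broucke, G. Debruyne, Sz. Gy. Révész, *Some examples of well-behaved Beurling
  number systems*, arXiv:2309.01567, Theorem 3.2 and its proof (read).
* [BrouckeVindas2024] F. Broucke, J. Vindas, *A new generalized prime random approximation procedure and some of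
  its applications*, Math. Z. 307 (2024), Theorem 1.2.
-/

noncomputable section

open Filter Topology Complex Set MeasureTheory
open scoped ComplexConjugate

namespace Literature.NumberTheory.BeurlingPrimes

open Literature.Barriers.RiemannHypothesis

namespace BDRMultiset

variable {R S : Multiset ℂ} {δ : ℝ} {M : ℕ} {P : BeurlingPrimes}

/-- `Z(s̄) = \overline{Z(s)}` for `Z = Zfn` (a real kernel against `x^{−s−1}`). [folklore] -/
theorem Zfn_conj (s : ℂ) : Zfn R S δ M P (conj s) = conj (Zfn R S δ M P s) := by
  rw [Zfn, Zfn, map_mul, ← integral_conj]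
  congr 1
  refine setIntegral_congr_fun measurableSet_Ioi fun x hx ↦ ?_
  have hx0 : 0 ≤ x := le_of_lt (lt_trans one_pos hx)
  rw [map_mul, Complex.conj_ofReal]
  congr 1
  rw [show -conj s - 1 = conj (-s - 1) by simp [map_sub, map_neg], Complex.cpow_conj _ _
    (by rw [Complex.arg_ofReal_of_nonneg hx0]; exact Real.pi_ne_zero.symm), Complex.conj_ofReal]

end BDRMultiset

/-- **Broucke–Debruyne–Révész 2023, Theorem 3.2, proved** (complex multisets of zeros and poles).
[cite: BrouckeDebruyneRevesz2023, Theorem 3.2 and its proof (§3)] -/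
theorem BrouckeDebruyneRevesz2023_thm32_multiset_holds : BrouckeDebruyneRevesz2023_thm32_multiset := by
  intro R S δ hRsymm hSsymm hRS hR hS hδ hδ2
  have hδ0 : 0 ≤ δ := hδ.le
  have hδ1 : δ ≤ 1 := by linarith
  have hS1 : ∀ ω ∈ S, ω.re ≤ 1 := fun ω hω ↦ (hS ω hω).2.le
  have hR1 : ∀ ρ ∈ R, ρ.re ≤ 1 := fun ρ hρ ↦ (hR ρ hρ).2.le
  have hS1' : ∀ ω ∈ S, ω.re < 1 := fun ω hω ↦ (hS ω hω).2
  have hR1' : ∀ ρ ∈ R, ρ.re < 1 := fun ρ hρ ↦ (hR ρ hρ).2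
  have hS01 : ∀ ω ∈ S, 0 < ω.re ∧ ω.re ≤ 1 := fun ω hω ↦ ⟨(hS ω hω).1, (hS ω hω).2.le⟩
  have hR01 : ∀ ρ ∈ R, 0 < ρ.re ∧ ρ.re ≤ 1 := fun ρ hρ ↦ ⟨(hR ρ hρ).1, (hR ρ hρ).2.le⟩
  -- Lemma 3.1: choose `M`
  obtain ⟨M0, hM0⟩ := BDRMultiset.exists_M0_NF_pos (R := R) (S := S) hS1' hR1' hδ hδ1
  set M : ℕ := M0 with hM
  have hpos : ∀ L : ℝ, 0 < L → 0 ≤ BDRMultiset.NF R S δ M L := by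
    intro L hL
    have h := hM0 M le_rfl (Real.exp L) (by simpa using hL)
    rw [Real.log_exp] at h
    exact h.le
  -- Theorem 1.2 applied to the template
  set F := BDRMultiset.tmplStieltjes (R := R) (S := S) (M := M) hδ0 hδ1 hpos with hF
  have hF1 : F 1 = 0 := by
    rw [hF, BDRMultiset.tmplStieltjes_apply]; exact BDRMultiset.tmplF_of_le_one le_rfl
  have hF0 : ∀ x : ℝ, 0 ≤ F x := fun x ↦ by
    rw [hF, BDRMultiset.tmplStieltjes_apply]; exact BDRMultiset.tmplF_nonneg hδ0 hδ1 hpos x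
  have hFinf : Tendsto (fun x : ℝ ↦ F x) atTop atTop := by
    have := BDRMultiset.tendsto_tmplF_atTop (M := M) hS1' hR1' hδ0 hδ1 hpos
    exact this.congr fun x ↦ by rw [hF, BDRMultiset.tmplStieltjes_apply]
  have hFcheb : ∃ C : ℝ, ∀ x : ℝ, 2 ≤ x → F x ≤ C * x / Real.log x := by
    obtain ⟨C, hC⟩ := BDRMultiset.tmplF_chebyshev (M := M) hS1 hR1 hδ0 hδ1 hpos
    exact ⟨C, fun x hx ↦ by rw [hF, BDRMultiset.tmplStieltjes_apply]; exact hC x hx⟩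
  obtain ⟨⟨P, hπ2, A, hA⟩, -⟩ := BrouckeVindas2024_thm12_holds F hF1 hF0 hFinf hFcheb
  have hπ : ∀ y : ℝ, 1 ≤ y → |(P.primeCount y : ℝ) - BDRMultiset.tmplF R S δ M y| ≤ 2 := fun y _ ↦ by
    have := hπ2 y; rwa [hF, BDRMultiset.tmplStieltjes_apply] at this
  have hApprox : BV.Approx (BDRMultiset.densF R S δ M) P A := by
    intro x hx t
    have h := hA t x hx
    rw [hF, BDRMultiset.stieltjesExpSum_tmplStieltjes hS1 hR1 hδ0 hδ1 hpos hx t] at h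
    simpa [BV.gauge] using h
  -- the `ψ`-clause and `Π_𝒫 − G = O(log x)`
  obtain ⟨Cψ, hψ⟩ := BDRMultiset.chebyshevPsi_clause (M := M) hSsymm hRsymm hS01 hR01 hδ hδ1 hpos hπ
  obtain ⟨CP, _, hPiG⟩ := BDRMultiset.exists_abs_riemannPrimeCount_sub_tmplG_le (M := M) hS1 hR1 hδ0 hδ1 hpos hπ
  -- `Z`
  set Zf : ℂ → ℂ := BDRMultiset.Zfn R S δ M P with hZf
  have hZd : DifferentiableOn ℂ Zf {s : ℂ | 0 < s.re} := BDRMultiset.differentiableOn_Zfn hδ0 hδ1 hPiG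
  obtain ⟨CZ, hZb⟩ := BDRMultiset.norm_Zfn_le (M := M) hS1 hR1 hδ0 hδ1 hpos hApprox hPiG
  -- `ζ_𝒫 = E_M e^Z`
  have hsum : ∀ σ : ℝ, 1 < σ → Summable fun j ↦ P.prime j ^ (-σ) := fun σ hσ ↦
    (BDRMultiset.approx_fTrunc hS1 hR1 hδ0 hδ1 hpos hApprox).summable_prime_rpow_neg
      (BDRMultiset.abs_fTrunc_le_two (M := M) hS1 hR1 hδ0 hδ1 hpos) hσ
  have hzeta : ∀ s : ℂ, 1 < s.re → P.zeta s = bdrE R S δ M s * Complex.exp (Zf s) := fun s hs ↦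
    BDRMultiset.zeta_eq_bdrE_mul_exp_Zfn hSsymm hRsymm hS1 hR1 hδ0 hδ1 hsum
      (fun s hs ↦ BDRMultiset.integrableOn_riemannPrimeCount_mul_cpow hS1 hR1 hδ0 hδ1 hPiG hs) hs
  -- the Perron hypotheses (constant made non-negative)
  set CZ' : ℝ := max CZ 0 with hCZ'
  have hZb' : ∀ σ t : ℝ, 1 / 2 < σ →
      ‖Zf (σ + t * I)‖ ≤ CZ' * (σ / (σ - 1 / 2) + σ * Real.sqrt (Real.log (|t| + 1) / (σ - 1 / 2))) := by
    intro σ t hσ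
    refine (hZb σ t hσ).trans (mul_le_mul_of_nonneg_right (le_max_left _ _) ?_)
    have h1 : 0 ≤ σ / (σ - 1 / 2) := div_nonneg (by linarith) (by linarith)
    have h2 : 0 ≤ σ * Real.sqrt (Real.log (|t| + 1) / (σ - 1 / 2)) := mul_nonneg (by linarith) (Real.sqrt_nonneg _)
    linarith
  have hPH : BDRMultiset.PerronHypM R S δ M Zf P CZ' :=
    { hS := hS, hR := hR, hδ := hδ0, hδ2 := hδ2, hRS := hRS,
      hZd := hZd.mono fun s hs ↦ by simp only [mem_setOf_eq] at hs ⊢; linarith,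
      hC := le_max_right _ _, hZb := hZb',
      hzeta := fun s hs ↦ by rw [BDRMultiset.contZ]; exact hzeta s hs,
      hsum := hsum }
  have hZsymm : ∀ s, Zf (conj s) = conj (Zf s) := fun s ↦ BDRMultiset.Zfn_conj s
  obtain ⟨CN, hN⟩ := hPH.intCount_clause hSsymm hRsymm hZsymm
  -- positivity of `a` and `c`
  have hZ1 : DifferentiableAt ℂ Zf 1 :=
    hZd.differentiableAt ((isOpen_lt continuous_const Complex.continuous_re).mem_nhds (by norm_num))
  have ha0 : 0 < (BDRMultiset.resA R S δ M Zf).re :=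
    (BDRMultiset.resA_real_pos hδ2 hS1' hR1' (fun s hs ↦ by rw [BDRMultiset.contZ]; exact hzeta s hs) hZ1).2
  have hc0 : 0 < BV.cexpo (3 / 2 * CZ') + 2 * Multiset.card S := by
    have : 0 ≤ CZ' := le_max_right _ _
    unfold BV.cexpo; positivity
  refine ⟨P, (BDRMultiset.resA R S δ M Zf).re, BV.cexpo (3 / 2 * CZ') + 2 * Multiset.card S,
    BDRMultiset.bCoef R S δ M Zf, M, Zf, ha0, hc0, ⟨Cψ, hψ⟩, ?_, ?_, ⟨CN, hN⟩, hzeta, hZd, ⟨CZ, hZb⟩⟩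
  · intro ω _ j
    exact BDRMultiset.bCoef_conj hSsymm hRsymm hZsymm ω j
  · intro ω hω hω2
    exact BDRMultiset.bCoef_top_ne_zero hRS hδ2 hω hω2 (hS1' ω hω)

end Literature.NumberTheory.BeurlingPrimes
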